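import Summits.AtomisticToContinuum.Crystallization.Theorems.ExcessDecayLiouvillePhononStabilityLatticeSum
import Summits.AtomisticToContinuum.Crystallization.Theorems.ExcessDecayLiouvillePhononStabilityLabels
import Summits.AtomisticToContinuum.Crystallization.Theorems.ExcessDecayLiouvillePhononStabilityPullback
import Summits.AtomisticToContinuum.Crystallization.Theorems.ExcessDecayLiouvillePhononStabilityWindow
import Summits.AtomisticToContinuum.Crystallization.Theorems.ExcessDecayLiouvillePhononStabilityFarDefs
import Summits.AtomisticToContinuum.Crystallization.Theorems.ExcessDecayLiouvillePhononStabilityChainBound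
import Summits.AtomisticToContinuum.Crystallization.Theorems.ExcessDecayLiouvillePhononStabilityPathBound
import Summits.AtomisticToContinuum.Crystallization.Theorems.ExcessDecayLiouvillePhononStabilityLatticeCount
import Summits.AtomisticToContinuum.Crystallization.Theorems.ExcessDecayLiouvillePhononStabilityTailSum
import Summits.AtomisticToContinuum.Crystallization.Theorems.ExcessDecayLiouvillePhononStabilityFarControl
import Summits.AtomisticToContinuum.Crystallization.Theorems.ExcessDecayLiouvillePhononStabilityVtxDefs
import Summits.AtomisticToContinuum.Crystallization.Theorems.ExcessDecayLiouvillePhononStabilityCertSymmHcp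

/-!
# Line `bloch-symbol-window` for crux `ExcessDecayLiouville.PhononStability`
# (item stmt-AtomisticToContinuum-9333) — STRATEGIST r1 SKELETON (planner-cstrat-stmt-AtomisticToContinuum-9333-r1)

Crux (concluded BY NAME by `PhononStability_of` at the bottom):
`Summit.AtomisticToContinuum.Crystallization.Theses.ExcessDecayLiouville.PhononStability`.

THE LINE.  Everything the live line `contragredient-window-collapse` has LANDED is reused verbatim (S0 lattice sum,
S1a label model, S1b pull-back, S2 window geometry, S6–S10 far field, the lattice-symmetry reduction to the in-plane
fundamental domain `CertSymmHcp`): the composition `composition5` below is the lead's v8 composition, letter for letter.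
The ONE open stub of the live line, `NearCertificateF` (the exact finite-range form dominates `2κ·N` plus the three far
charges, uniformly on the window ∩ fundamental domain), is discharged here on the FOURIER side instead of by
star-supported sum-of-squares identities at grid nodes:

* `stub_pairIdentity` (bookkeeping, M): the two sides of the near inequality differ by ONE finite-range PAIR FORM
  `Σ_{c ∈ s} Σ_k (Δ_c w k)ᵀ C_c (Δ_c w k)` on the labelled two-lattice `Fin 2 × ℤ³`, with explicit real `3×3` class
  matrices `nearClassMatrix` (class terms `ω_c ζ_cζ_cᵀ + ψ_c BᵀB` on `‖ζ⁰‖ ≤ Rn`; `−2κ BᵀB − K·1` on the 24 nearest-neighbour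
  classes; chain charges redistributed on their step classes WITH MULTIPLICITY `count`).
* `stub_bloch` (analytic, L, reusable summit-wide): BLOCH REDUCTION for finite-range pair forms — if the `6×6` Hermitian
  symbol `Σ_c D_c(θ)ᴴ C_c D_c(θ)`, `D_c(θ)v = e^{iθ·n} v_{m'} − v_m`, is positive semidefinite at every wave vector then the
  pair form is nonnegative on finitely supported fields (Plancherel on a finite torus `(ℤ/Lℤ)³`, `L >` support diameter +
  range; Schmidt–Steinbach 2022 Thm 3.22 / Hudson–Ortner 2012 §3 specialised to the two-lattice).  The criterion is EXACT
  (PSD symbol ⟺ nonnegative form): no representability gap.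
* `stub_symbolCert` (computational, XL, THE HARDEST STUB): for some certificate parameters the symbol of the near pair
  form is PSD at every wave vector and every datum of the window ∩ fundamental domain.  Intended proof (line card
  `Lines/bloch-symbol-window.md`): SPECTRAL COORDINATES for the datum (principal stretches, principal frame, shift in
  polar form — the window IS a box there, its dilation-extreme sheets are faces, so no cell vertex lies outside the
  window), θ-wise VERTEX INTERPOLATION on the boxes with the tangent minorant of the convex `ω` and the chord minorant of
  the concave `ψ` (second-order cells, half-width ≈ 0.0125 in stretch / 0.008 in shift at the worst corner), and at each
  node a CERTIFIED HERMITIAN EIGENVALUE ENCLOSURE over `θ ∈ T³` by branch-and-bound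
  (`Literature.Analysis.ValidatedNumerics.ParametricEigenScan`, landed), the neighbourhood of `θ = 0` by the acoustic
  blow-up (the `3×3` Schur-complement pencil on `S²`, where the window minimum `κ* ≈ 0.105` sits).

Honours the disproof obligations: `CellWindow`/`Adm₀` and `ShiftWindow`/`Inner₀` are hypotheses of `stub_symbolCert`
(`phononStability_false_without_Adm`, `phononStability_false_without_Inner`); no window enlargement
(`phononStability_false_at_radius_one_30th`); `κ` is existential, target `1/20 ≤ κ* ≈ 0.105`.
-/

noncomputable section

open scoped BigOperators Classical InnerProductSpace ComplexConjugate
open Filter Set Function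
open Literature.MathematicalPhysics.StatisticalMechanics
open Summit.AtomisticToContinuum.Crystallization.Theses.ExcessDecayLiouville
open Summit.AtomisticToContinuum.Crystallization.Theorems.PhononStabilityNegative
open Summit.AtomisticToContinuum.Crystallization.Theorems.PhononStabilityCWC

namespace Summit.AtomisticToContinuum.Crystallization.Cruxes.PhononStability.BlochSymbolWindow

local notation "E3" => EuclideanSpace ℝ (Fin 3)

/-! ## Finite-range pair forms on the labelled two-lattice and their Bloch symbol -/

/-- A finite-range PAIR FORM on label fields: `Σ_{c ∈ s} Σ_k (Δ_c w k)ᵀ (C c) (Δ_c w k)` with real `3×3` class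
matrices (only the symmetric part of `C c` matters). [folklore] -/
def pairForm (s : Finset BondClass) (C : BondClass → Matrix (Fin 3) (Fin 3) ℝ) (w : Label → E3) : ℝ :=
  ∑ c ∈ s, ∑' k, ∑ i : Fin 3, ∑ j : Fin 3, (bondDiff c w k) i * C c i j * (bondDiff c w k) j

/-- The Bloch DIFFERENCE SYMBOL of class `c = (m, m', n)` on a cell amplitude `v : Fin 2 → ℂ³` at wave vector `θ`
(integer lattice coordinates, `2π`-periodic): `e^{iθ·n} v_{m'} − v_m`. [folklore] -/
def diffSymbol (c : BondClass) (θ : Fin 3 → ℝ) (v : Fin 2 → Fin 3 → ℂ) : Fin 3 → ℂ :=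
  fun i => Complex.exp (Complex.I * ((∑ j : Fin 3, θ j * (c.2.2 j : ℝ) : ℝ) : ℂ)) * v c.2.1 i - v c.1 i

/-- The `6×6` Hermitian SYMBOL of the pair form at `θ`, evaluated on the amplitude `v`:
`Re Σ_{c ∈ s} (D_c v)ᴴ (C c) (D_c v)` (real for symmetric `C c`; the antisymmetric part drops out of both the pair
form and this real part). [folklore] -/
def symbolForm (s : Finset BondClass) (C : BondClass → Matrix (Fin 3) (Fin 3) ℝ) (θ : Fin 3 → ℝ)
    (v : Fin 2 → Fin 3 → ℂ) : ℝ :=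
  (∑ c ∈ s, ∑ i : Fin 3, ∑ j : Fin 3, conj (diffSymbol c θ v i) * (C c i j : ℂ) * diffSymbol c θ v j).re

/-- **S-B1 — BLOCH REDUCTION FOR FINITE-RANGE PAIR FORMS** (analytic, L, reusable): a pair form whose symbol is
positive semidefinite at every wave vector is nonnegative on every finitely supported label field.  Proof route:
embed the support in a discrete torus `(ℤ/Lℤ)³` with `L` larger than support diameter + class range (no wrap-around),
discrete Plancherel for `ℂ³`-valued functions on `Fin 2 × (ℤ/Lℤ)³`, and the symbol inequality at the `L³` discrete
wave vectors `θ ∈ (2π/L)ℤ³`. [cite: SchmidtSteinbach2022, Thm 3.22; HudsonOrtner2012, §3] -/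
def BlochReduction : Prop :=
  ∀ (s : Finset BondClass) (C : BondClass → Matrix (Fin 3) (Fin 3) ℝ),
    (∀ (θ : Fin 3 → ℝ) (v : Fin 2 → Fin 3 → ℂ), 0 ≤ symbolForm s C θ v) →
      ∀ w : Label → E3, (Function.support w).Finite → 0 ≤ pairForm s C w

/-! ## The near pair form of `NearCertificateF`: class matrices and support -/

/-- Gram entries of the metric `BᵀB` in the standard basis: `g_ij = ⟪B eᵢ, B eⱼ⟫` (`‖BΔ‖² = Σ_ij Δᵢ g_ij Δⱼ`). [folklore] -/
def gramB (B : E3 →L[ℝ] E3) (i j : Fin 3) : ℝ :=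
  inner ℝ (B (EuclideanSpace.single i 1)) (B (EuclideanSpace.single j 1))

/-- The class matrices of the NEAR PAIR FORM at a datum `(A, B, δ)` for certificate parameters
`(κ, Rn, Rf, R∞, chain, P)`: exact class terms `ω_c ζ_c(δ)ζ_c(δ)ᵀ + ψ_c BᵀB` on `‖ζ⁰_c‖ ≤ Rn`; minus `2κ BᵀB` and the
scalar mid-range + tail constant `K = Σ_{(Rf,R∞]} farCoeff·P + 40000/R∞³` times `1` on the nearest-neighbour classes;
minus the chain charges of the far classes `c' ∈ (Rn, Rf]` redistributed on their step classes `c` WITH MULTIPLICITY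
`(chain c').count c` (a chain may repeat a step class): `|ω_{c'}|·W(chain c')·‖ζ⁰_c‖⁻¹·ζ_{c'}(δ)ζ_{c'}(δ)ᵀ` per
occurrence. [folklore] -/
def nearClassMatrix (κ Rn Rf Rinf : ℝ) (chain : BondClass → List BondClass) (P : BondClass → ℝ)
    (A B : E3 →L[ℝ] E3) (δ : E3) (c : BondClass) : Matrix (Fin 3) (Fin 3) ℝ :=
  fun i j =>
    (if c ∈ classesR Rn then
        omegaLJ ‖A (bondVec δ c)‖ * (bondVec δ c) i * (bondVec δ c) j + psiLJ ‖A (bondVec δ c)‖ * gramB B i j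
      else 0) -
    (if c ∈ nnClasses then
        2 * κ * gramB B i j +
          ((∑ c' ∈ farClasses Rf Rinf, farCoeff c' * P c') + 40000 / Rinf ^ 3) * (if i = j then 1 else 0)
      else 0) -
    ∑ c' ∈ farClasses Rn Rf,
      |omegaLJ ‖A (bondVec δ c')‖| * chainConst (chain c') * (((chain c').count c : ℕ) : ℝ) *
        ‖bondVec 0 c‖⁻¹ * (bondVec δ c') i * (bondVec δ c') j

/-- The finite class support of the near pair form: exact range, nearest neighbours, all chain steps. [folklore] -/
def nearSupport (Rn Rf : ℝ) (chain : BondClass → List BondClass) : Finset BondClass :=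
  classesR Rn ∪ nnClasses ∪ (farClasses Rn Rf).biUnion fun c' => (chain c').toFinset

/-- **S-B2 — NEAR PAIR IDENTITY** (bookkeeping, M): for every choice of parameters and every finitely supported field,
right side minus left side of the near inequality of `NearCertificateF` IS the pair form with class matrices
`nearClassMatrix` on `nearSupport` (`longForm = Σ_k Σ_ij ΔᵢζᵢζⱼΔⱼ`, `metricForm = Σ_k Σ_ij Δᵢ g_ij Δⱼ`,
`plainForm = Σ_k Σ_i Δᵢ²`, `dirForm v s = Σ_k Σ_ij Δᵢvᵢvⱼ Δⱼ`; `tsum`s of finitely supported summands are finite sums, so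
linearity is unconditional; the list sum of a chain equals the `count`-weighted sum over its `toFinset`,
`Finset.sum_list_map_count`). No window hypothesis is needed. [folklore] -/
def NearPairIdentity : Prop :=
  ∀ (κ Rn Rf Rinf : ℝ) (chain : BondClass → List BondClass) (P : BondClass → ℝ)
    (A B : E3 →L[ℝ] E3) (δ : E3) (w : Label → E3), (Function.support w).Finite →
      (∑ c ∈ classesR Rn, classTerm A B δ w c) -
          (2 * κ * (∑ c ∈ nnClasses, metricForm B c w) + chargeSum Rn Rf chain A δ w
            + (∑ c ∈ farClasses Rf Rinf, farCoeff c * P c) * N0 w + 40000 / Rinf ^ 3 * N0 w)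
        = pairForm (nearSupport Rn Rf chain) (nearClassMatrix κ Rn Rf Rinf chain P A B δ) w

/-- **S-B3 — NEAR SYMBOL CERTIFICATE on the window ∩ fundamental domain** (computational, XL, THE HARDEST STUB):
certificate parameters as in `NearCertificateF` (`κ > 0`, ranges `2 ≤ Rn ≤ Rf ≤ R∞`, `R∞ ≥ 100`, a valid chain
assignment on `(Rn, Rf]`, a mid-range assignment with `MidBound` on `(Rf, R∞]`), and at EVERY datum of the window with
`StretchOrdered A` and EVERY wave vector the symbol of the near pair form is positive semidefinite.  Numerically the
symbol's generalized bottom eigenvalue against the nearest-neighbour symbol is `≥ 2·0.1048` on the whole window (minimum at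
the corner stretches `(0.945, 0.945, 0.995)`, tilted frame, `‖Aδ‖ = 1/40`, long-wave quasi-transverse acoustic mode;
certified in outward-rounded interval arithmetic at 46 extreme data incl. the minimiser at `κ = 0.08`, kit j018799), so
the target is `κ = 1/20` with `Rn = 2`.  The symbol is `2π`-periodic in each `θ_j`; near `θ ∈ 2πℤ³` the acoustic block
degenerates and is handled by the blow-up `D(θ) = |θ|²·(acoustic pencil) + O(|θ|³)` with explicit fourth-moment
remainder (line card). [folklore] -/
def NearSymbolCertificate : Prop :=
  ∃ κ : ℝ, 0 < κ ∧ ∃ (Rn Rf Rinf : ℝ) (chain : BondClass → List BondClass) (P : BondClass → ℝ),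
    2 ≤ Rn ∧ Rn ≤ Rf ∧ Rf ≤ Rinf ∧ 100 ≤ Rinf ∧ ValidChains Rn Rf chain ∧ MidBound Rf Rinf P ∧
    ∀ (A B : E3 →L[ℝ] E3) (δ : E3), CellWindow A → ShiftWindow A δ → Contragredient A B → StretchOrdered A →
      ∀ (θ : Fin 3 → ℝ) (v : Fin 2 → Fin 3 → ℂ),
        0 ≤ symbolForm (nearSupport Rn Rf chain) (nearClassMatrix κ Rn Rf Rinf chain P A B δ) θ v

/-! ## Landed inputs (aliases of the live line's nine landed stubs) and the THREE registered stubs of this line -/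

/-- S0 — LANDED (`Theorems/ExcessDecayLiouvillePhononStabilityLatticeSum.lean`, p94846). -/
theorem landed_latticeSum : LatticeSum := LatticeSumStub.stub_latticeSum

/-- S1a — LANDED (`Theorems/ExcessDecayLiouvillePhononStabilityLabels.lean`, p91918). -/
theorem landed_labels : LabelModel := LabelsStub.stub_labels

/-- S1b — LANDED (`Theorems/ExcessDecayLiouvillePhononStabilityPullback.lean`, p94865; per-bond part p92825). -/
theorem landed_pullback : PullbackReduction := PullbackStub.stub_pullback

/-- S2 — LANDED (`Theorems/ExcessDecayLiouvillePhononStabilityWindow.lean`, p93342). -/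
theorem landed_window : WindowGeometry := WindowStub.stub_window

/-- S6 — LANDED (`Theorems/ExcessDecayLiouvillePhononStabilityChainBound.lean`). -/
theorem landed_chainBound : ChainBound := ChainBoundStub.stub_chainBound

/-- S7 — LANDED (`Theorems/ExcessDecayLiouvillePhononStabilityPathBound.lean`). -/
theorem landed_pathBound : PathBound := PathBoundStub.stub_pathBound

/-- S8 — LANDED (`Theorems/ExcessDecayLiouvillePhononStabilityLatticeCount.lean`). -/
theorem landed_latticeCount : LatticeCount := LatticeCountStub.stub_latticeCount

/-- S9 — LANDED (`Theorems/ExcessDecayLiouvillePhononStabilityTailSum.lean`). -/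
theorem landed_tailSum : TailSum := TailSumStub.stub_tailSum

/-- S10 — LANDED (`Theorems/ExcessDecayLiouvillePhononStabilityFarControl.lean`). -/
theorem landed_farControl : FarControl := FarControlStub.stub_farControl

/-- S-B1 — BLOCH REDUCTION for finite-range pair forms on the two-lattice (analytic, L).  OPEN. -/
theorem stub_bloch : BlochReduction := by
  sorry

/-- S-B2 — NEAR PAIR IDENTITY (bookkeeping, M).  OPEN. -/
theorem stub_pairIdentity : NearPairIdentity := by
  sorry

/-- S-B3 — NEAR SYMBOL CERTIFICATE on the fundamental domain (computational, XL, THE HARDEST STUB).  OPEN. -/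
theorem stub_symbolCert : NearSymbolCertificate := by
  sorry

/-! ## The kernel-checked composition -/

/-- **Glue of the Fourier-side split** (proved): Bloch reduction + the pair identity + the symbol certificate give the
live line's open stub `NearCertificateF` with the same parameters. -/
theorem nearCertificateF_of_symbol (hB : BlochReduction) (hI : NearPairIdentity) (hS : NearSymbolCertificate) :
    NearCertificateF := by
  obtain ⟨κ, hκ, Rn, Rf, Rinf, chain, P, hRn, hRnf, hRfi, hRinf, hvalid, hmid, hsym⟩ := hS
  refine ⟨κ, hκ, Rn, Rf, Rinf, chain, P, hRn, hRnf, hRfi, hRinf, hvalid, hmid, ?_⟩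
  intro A B δ w hW hδ hAB hSO hw
  have hpsd : ∀ (θ : Fin 3 → ℝ) (v : Fin 2 → Fin 3 → ℂ),
      0 ≤ symbolForm (nearSupport Rn Rf chain) (nearClassMatrix κ Rn Rf Rinf chain P A B δ) θ v :=
    hsym A B δ hW hδ hAB hSO
  have hpair : 0 ≤ pairForm (nearSupport Rn Rf chain) (nearClassMatrix κ Rn Rf Rinf chain P A B δ) w :=
    hB _ _ hpsd w hw
  have hid := hI κ Rn Rf Rinf chain P A B δ w hw
  linarith [hpair, hid]

/-- The metric functional of a diagonal class vanishes. [folklore] -/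
theorem metricForm_diag (B : E3 →L[ℝ] E3) (w : Label → E3) {c : BondClass} (hc : diagClass c) :
    metricForm B c w = 0 := by
  obtain ⟨m, m', n⟩ := c
  obtain ⟨h1, h2⟩ := hc
  simp only at h1 h2
  subst h1; subst h2
  simp [metricForm, bondDiff]

/-- Bond-graph constancy turns the metric cut-off of `Nform` into the finite nearest-neighbour sum. [folklore] -/
theorem Nform_eq_sum {A B : E3 →L[ℝ] E3} {δ : E3} {w : Label → E3}
    (hgraph : ∀ c : BondClass, ¬ diagClass c → (c ∈ nnClasses ↔ ‖A (bondVec δ c)‖ ≤ 11 / 10)) :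
    Nform A B δ w = ∑ c ∈ nnClasses, metricForm B c w := by
  have key : ∀ c : BondClass, (if ‖A (bondVec δ c)‖ ≤ 11 / 10 then metricForm B c w else 0) =
      if c ∈ nnClasses then metricForm B c w else 0 := by
    intro c
    by_cases hd : diagClass c
    · simp [metricForm_diag B w hd]
    · by_cases hc : c ∈ nnClasses
      · rw [if_pos ((hgraph c hd).1 hc), if_pos hc]
      · rw [if_neg (fun h => hc ((hgraph c hd).2 h)), if_neg hc]
  unfold Nform
  rw [tsum_congr key, tsum_eq_sum (s := nnClasses) (fun c hc => if_neg hc)]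
  exact Finset.sum_congr rfl fun c hc => if_pos hc

/-- Splitting `Hform` at range `R`: finite part plus far `tsum`, for a summable class family. [folklore] -/
theorem Hform_eq_sum_add_tsum {A B : E3 →L[ℝ] E3} {δ : E3} {w : Label → E3} (R : ℝ)
    (hs : Summable (classTerm A B δ w)) :
    Hform A B δ w = (∑ c ∈ classesR R, classTerm A B δ w c) +
      ∑' c, if c ∈ classesR R then 0 else classTerm A B δ w c := by
  unfold Hform
  have h1 : (fun c => classTerm A B δ w c) =
      fun c => (if c ∈ classesR R then classTerm A B δ w c else 0) +
        (if c ∈ classesR R then 0 else classTerm A B δ w c) := by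
    funext c; split_ifs <;> simp
  have hfin : Summable fun c => if c ∈ classesR R then classTerm A B δ w c else 0 :=
    summable_of_hasFiniteSupport ((classesR R).finite_toSet.subset (by
      intro c hc; by_contra h; exact hc (if_neg h)))
  have hfar : Summable fun c => if c ∈ classesR R then 0 else classTerm A B δ w c := by
    have : (fun c => if c ∈ classesR R then 0 else classTerm A B δ w c) =
        fun c => classTerm A B δ w c - if c ∈ classesR R then classTerm A B δ w c else 0 := by
      funext c; split_ifs <;> simp
    rw [this]; exact hs.sub hfin
  rw [show (∑' c, classTerm A B δ w c) = ∑' c, ((if c ∈ classesR R then classTerm A B δ w c else 0) +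
      (if c ∈ classesR R then 0 else classTerm A B δ w c)) from by rw [← h1], hfin.tsum_add hfar,
    tsum_eq_sum (s := classesR R) (fun c hc => if_neg hc)]
  congr 1
  exact Finset.sum_congr rfl fun c hc => if_pos hc

/-- `Σ_k ‖Δ_c w k‖² ≥ 0`. [folklore] -/
theorem plainForm_nonneg (c : BondClass) (w : Label → E3) : 0 ≤ plainForm c w :=
  tsum_nonneg fun _ => by positivity

/-- `N0 ≥ 0`. [folklore] -/
theorem N0_nonneg (w : Label → E3) : 0 ≤ N0 w :=
  Finset.sum_nonneg fun c _ => plainForm_nonneg c w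

/-- **Pure logic of the composition on the fundamental domain** (the live line's `composition5`, no sorry): label model
and pull-back at the datum; split `Hform` at range `Rn`; far control on `(Rn, ∞)`; tail sum; near certificate. -/
theorem composition5 (h0 : LatticeSum) (h1a : LabelModel) (h1 : PullbackReduction) (h2 : WindowGeometry)
    (hC : ChainBound) (hP : PathBound) (hL : LatticeCount) (hT : TailSum) (hF : FarControl)
    (hN : NearCertificateF) :
    PhononStabilityOn fun t A => Adm₀ A ∧ Inner₀ t A ∧ inPlaneOrdered t A := by
  obtain ⟨κ, hκ, Rn, Rf, Rinf, chain, P, hRn, hRnf, hRfi, hRinf, hvalid, hmid, hnear⟩ := hN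
  refine ⟨κ, hκ, ?_⟩
  rintro t A ⟨hAdm, hInn, hOrd⟩ u hu hsupp
  obtain ⟨B, δ, hW, hδ, hAB, hinj, hrange⟩ := h1a t A hAdm hInn
  obtain ⟨w, hw, hred⟩ := h1 t A B δ hW hδ hAB hinj hrange u hu hsupp
  have hls : LatticeSummable w := h0 w hw
  obtain ⟨hsum, hN, hH⟩ := hred hls
  obtain ⟨hgraph, -, -, -⟩ := h2 A δ hW hδ
  have hNf : Nform A B δ w = ∑ c ∈ nnClasses, metricForm B c w := Nform_eq_sum hgraph
  have hsplit := Hform_eq_sum_add_tsum Rn hsum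
  obtain ⟨hsumT, hTle⟩ := hT hL Rinf hRinf
  have hfar := hF hC hP Rn Rf Rinf hRn hRnf hRfi chain hvalid P hmid hsumT A B δ w hW hδ hw hls hsum
  have hnear' := hnear A B δ w hW hδ hAB ⟨hOrd.1, hOrd.2⟩ hw
  have hN0 : 0 ≤ N0 w := N0_nonneg w
  have hRinf3 : 0 < Rinf ^ 3 := by positivity
  have htc : farTailConst Rinf * N0 w ≤ 40000 / Rinf ^ 3 * N0 w := mul_le_mul_of_nonneg_right hTle hN0
  rw [hN, hH, hsplit, hNf]
  linarith [hfar, hnear', htc]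

/-- **The line concludes the crux BY NAME** (through the lattice symmetry to the fundamental domain, the live line's
landed far field, and the Fourier-side near certificate). -/
theorem PhononStability_of :
    Summit.AtomisticToContinuum.Crystallization.Theses.ExcessDecayLiouville.PhononStability :=
  phononStability_iff_on.mpr
    (phononStabilityOn_of_inPlaneOrdered
      (composition5 landed_latticeSum landed_labels landed_pullback landed_window landed_chainBound landed_pathBound
        landed_latticeCount landed_tailSum landed_farControl
        (nearCertificateF_of_symbol stub_bloch stub_pairIdentity stub_symbolCert)))

/-! ## Units sanity of the new vocabulary (proved) -/

/-- The difference symbol of the diagonal class vanishes at `θ = 0` (translations are in the kernel at `Γ`). [folklore] -/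
theorem diffSymbol_diag_zero (v : Fin 2 → Fin 3 → ℂ) (i : Fin 3) :
    diffSymbol ((0 : Fin 2), (0 : Fin 2), (0 : Fin 3 → ℤ)) 0 v i = 0 := by
  simp [diffSymbol]

/-- The pair form of the zero field vanishes. [folklore] -/
theorem pairForm_zero (s : Finset BondClass) (C : BondClass → Matrix (Fin 3) (Fin 3) ℝ) :
    pairForm s C 0 = 0 := by
  simp [pairForm, bondDiff]

end Summit.AtomisticToContinuum.Crystallization.Cruxes.PhononStability.BlochSymbolWindow

end
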